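import Mathlib.Analysis.SpecialFunctions.ExpDeriv
import Mathlib.Analysis.Calculus.Deriv.MeanValue
import Mathlib.MeasureTheory.Integral.IntervalIntegral.FundThmCalculus
import HarnessLib

/-!
# Monotone quantities with a forcing term: `G' ≤ K G - D`

Topic `Literature/Analysis/ODE`.  The elementary calculus behind monotonicity formulas WITH
FORCING (White 2005, Thm. 4.1 and (10) on p. 1501: for a mean curvature flow with bounded forcing
`|β| ≤ b` the corrected Gaussian density `e^{C b² r²} Θ(𝓜, X, r)` is non-decreasing, the defect
being controlled by its increments).  If `G` is continuous on `[a, b]`, differentiable on `(a, b)`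
with `G' ≤ K G - D` for a constant `K` and a DEFECT `D ≥ 0`, then

* `antitoneOn_exp_neg_mul` — `t ↦ e^{-K t} G(t)` is non-increasing on `[a, b]`
  (so `G(t₂) ≤ e^{K (t₂ - t₁)} G(t₁)`, `le_exp_mul_of_deriv_le`);
* `integral_exp_neg_mul_defect_le` — `∫_a^b e^{-K t} D(t) dt ≤ e^{-K a} G(a) - e^{-K b} G(b)` when
  `G'` and `D` are continuous on `[a, b]`: the total defect is paid for by the drop of the
  corrected quantity (the equality case `D ≡ 0` is how self-shrinkers are detected in the limit).

Everything is PROVED; no definitions, no named facts.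

## References

* B. White, *A local regularity theorem for mean curvature flow*, Ann. of Math. 161 (2005),
  §4, (10) p. 1501. [White2005]
* G. Huisken, *Asymptotic behavior for singularities of the mean curvature flow*, J. Differential
  Geom. 31 (1990), Thm. 3.1. [Huisken1990]
-/

noncomputable section

open Set Filter MeasureTheory intervalIntegral
open scoped Topology

namespace Literature.Analysis.ODE

/-- **`G' ≤ K G - D`, `D ≥ 0` ⟹ `e^{-Kt} G` is non-increasing.** [cite: White2005, §4 (10)] -/
theorem antitoneOn_exp_neg_mul {G G' D : ℝ → ℝ} {K a b : ℝ}
    (hGc : ContinuousOn G (Icc a b)) (hGd : ∀ t ∈ Ioo a b, HasDerivAt G (G' t) t)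
    (hle : ∀ t ∈ Ioo a b, G' t ≤ K * G t - D t) (hD : ∀ t ∈ Ioo a b, 0 ≤ D t) :
    AntitoneOn (fun t => Real.exp (-K * t) * G t) (Icc a b) := by
  have hc : ContinuousOn (fun t => Real.exp (-K * t) * G t) (Icc a b) :=
    (Real.continuous_exp.comp (continuous_const.mul continuous_id)).continuousOn.mul hGc
  have hd : ∀ t ∈ interior (Icc a b),
      HasDerivAt (fun t => Real.exp (-K * t) * G t)
        (Real.exp (-K * t) * (-K) * G t + Real.exp (-K * t) * G' t) t := by
    intro t ht
    rw [interior_Icc] at ht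
    have h1 : HasDerivAt (fun t => Real.exp (-K * t)) (Real.exp (-K * t) * (-K)) t := by
      have := ((hasDerivAt_id t).const_mul (-K)).exp
      simpa using this
    exact h1.mul (hGd t ht)
  refine antitoneOn_of_deriv_nonpos (convex_Icc a b) hc
    (fun t ht => (hd t ht).differentiableAt.differentiableWithinAt) fun t ht => ?_
  rw [(hd t ht).deriv]
  rw [interior_Icc] at ht
  have hpos : 0 < Real.exp (-K * t) := Real.exp_pos _
  have h := hle t ht
  have h0 := hD t ht
  nlinarith [mul_le_mul_of_nonneg_left h hpos.le]

/-- **Growth bound**: `G(t₂) ≤ e^{K (t₂ - t₁)} G(t₁)` for `a ≤ t₁ ≤ t₂ ≤ b`.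
[cite: White2005, §4 (10)] -/
theorem le_exp_mul_of_deriv_le {G G' D : ℝ → ℝ} {K a b : ℝ}
    (hGc : ContinuousOn G (Icc a b)) (hGd : ∀ t ∈ Ioo a b, HasDerivAt G (G' t) t)
    (hle : ∀ t ∈ Ioo a b, G' t ≤ K * G t - D t) (hD : ∀ t ∈ Ioo a b, 0 ≤ D t)
    {t₁ t₂ : ℝ} (h₁ : a ≤ t₁) (h₁₂ : t₁ ≤ t₂) (h₂ : t₂ ≤ b) :
    G t₂ ≤ Real.exp (K * (t₂ - t₁)) * G t₁ := by
  have hanti := antitoneOn_exp_neg_mul hGc hGd hle hD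
  have h := hanti ⟨h₁, h₁₂.trans h₂⟩ ⟨h₁.trans h₁₂, h₂⟩ h₁₂
  -- `e^{-K t₂} G t₂ ≤ e^{-K t₁} G t₁`
  have hpos : 0 < Real.exp (K * t₂) := Real.exp_pos _
  have hmul := mul_le_mul_of_nonneg_left h hpos.le
  have e1 : Real.exp (K * t₂) * (Real.exp (-K * t₂) * G t₂) = G t₂ := by
    rw [← mul_assoc, ← Real.exp_add]; simp
  have e2 : Real.exp (K * t₂) * (Real.exp (-K * t₁) * G t₁) = Real.exp (K * (t₂ - t₁)) * G t₁ := by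
    rw [← mul_assoc, ← Real.exp_add]; ring_nf
  rw [e1, e2] at hmul
  exact hmul

/-- **The defect is paid for by the drop of the corrected quantity**:
`∫_a^b e^{-Kt} D(t) dt ≤ e^{-Ka} G(a) - e^{-Kb} G(b)` (`G'`, `D` continuous on `[a, b]`, `a ≤ b`).
[cite: White2005, §4 (10)] [cite: Huisken1990, Thm. 3.1] -/
theorem integral_exp_neg_mul_defect_le {G G' D : ℝ → ℝ} {K a b : ℝ} (hab : a ≤ b)
    (hGc : ContinuousOn G (Icc a b)) (hGd : ∀ t ∈ Ioo a b, HasDerivAt G (G' t) t)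
    (hG'c : ContinuousOn G' (Icc a b)) (hDc : ContinuousOn D (Icc a b))
    (hle : ∀ t ∈ Ioo a b, G' t ≤ K * G t - D t) :
    ∫ t in a..b, Real.exp (-K * t) * D t ≤
      Real.exp (-K * a) * G a - Real.exp (-K * b) * G b := by
  set h : ℝ → ℝ := fun t => Real.exp (-K * t) * G t with hh
  set h' : ℝ → ℝ := fun t => Real.exp (-K * t) * (-K) * G t + Real.exp (-K * t) * G' t with hh'
  have hexpc : Continuous fun t => Real.exp (-K * t) :=
    Real.continuous_exp.comp (continuous_const.mul continuous_id)
  have hc : ContinuousOn h (Icc a b) := hexpc.continuousOn.mul hGc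
  have hd : ∀ t ∈ Ioo a b, HasDerivAt h (h' t) t := fun t ht => by
    have h1 : HasDerivAt (fun t => Real.exp (-K * t)) (Real.exp (-K * t) * (-K)) t := by
      have := ((hasDerivAt_id t).const_mul (-K)).exp
      simpa using this
    exact h1.mul (hGd t ht)
  have h'c : ContinuousOn h' (Icc a b) :=
    ((hexpc.continuousOn.mul continuousOn_const).mul hGc).add (hexpc.continuousOn.mul hG'c)
  have h'int : IntervalIntegrable h' volume a b :=
    (h'c.mono (by rw [uIcc_of_le hab])).intervalIntegrable
  have hftc : ∫ t in a..b, h' t = h b - h a :=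
    integral_eq_sub_of_hasDerivAt_of_le hab hc hd h'int
  have hDint : IntervalIntegrable (fun t => Real.exp (-K * t) * D t) volume a b :=
    ((hexpc.continuousOn.mul hDc).mono (by rw [uIcc_of_le hab])).intervalIntegrable
  have hmono : ∫ t in a..b, Real.exp (-K * t) * D t ≤ ∫ t in a..b, -h' t := by
    refine integral_mono_on_of_le_Ioo hab hDint h'int.neg fun t ht => ?_
    have hpos : 0 < Real.exp (-K * t) := Real.exp_pos _
    have h1 := mul_le_mul_of_nonneg_left (hle t ht) hpos.le
    simp only [hh']
    nlinarith
  calc ∫ t in a..b, Real.exp (-K * t) * D t ≤ ∫ t in a..b, -h' t := hmono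
    _ = -(h b - h a) := by rw [intervalIntegral.integral_neg, hftc]
    _ = Real.exp (-K * a) * G a - Real.exp (-K * b) * G b := by simp only [hh]; ring

end Literature.Analysis.ODE
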